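import Mathlib.Analysis.InnerProductSpace.PiL2
import Mathlib.LinearAlgebra.Matrix.Trace
import Mathlib.LinearAlgebra.Matrix.Hermitian
import HarnessLib

/-!
# Trace inequalities for powers of matrices (Golden, Koma–Tasaki)

Trunk T-QLATTICE (finite-dimensional matrix analysis used by the quantum-lattice statements;
consumer: the Koma–Tasaki bound `Literature.MathematicalPhysics.QuantumLattice.koma_tasaki_2d`, via the Bernstein and
Golden–Thompson trace inequalities of `GoldenThompson.lean`).

For square complex matrices we prove, with `tr` the trace and `Xᴴ` the conjugate transpose:

* `trace_mul_conjTranspose_self_eq`: `tr (X Xᴴ) = Σᵢⱼ |Xᵢⱼ|²` (a real, nonnegative number);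
* `norm_trace_mul_le_sqrt_mul_sqrt` — the Cauchy–Schwarz inequality for the Hilbert–Schmidt
  inner product, `|tr (A B)| ≤ (tr A Aᴴ)^{1/2} (tr Bᴴ B)^{1/2}` (Koma–Tasaki, PRL 68 (1992) 3248,
  inequality i));
* `trace_pow_mul_conjTranspose_comm`: `tr (X Xᴴ)^k = tr (Xᴴ X)^k`;
* the joint dyadic induction (Golden 1965; Lieb–Thirring 1976, App. B; Koma–Tasaki footnote 14):
  for `p = 2^j`,
  `norm_trace_pow_two_mul_le`: `|tr X^{2p}| ≤ tr (X Xᴴ)^p` for every `X`, and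
  `norm_trace_mul_pow_le`: `|tr (P Q)^p| ≤ |tr (P^p Q^p)|` for Hermitian `P, Q`;
* `trace_conjTranspose_pow_mul_pow_re_le` — Koma–Tasaki's inequality iii),
  `tr ((Xᴴ)^N X^N) ≤ tr (Xᴴ X)^N` for `N = 2^m`.

Sources: S. Golden, Phys. Rev. 137 (1965) B1127, Lemma; E. H. Lieb, W. Thirring, in *Studies in
Mathematical Physics* (Princeton 1976), Appendix B; T. Koma, H. Tasaki, PRL 68 (1992) 3248,
inequalities i)–iii) and footnote [14].

## Mathlib search

Mathlib has `Matrix.trace_mul_comm`, `Matrix.trace_mul_cycle`, `mul_pow_mul`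
(`(a b)^n a = a (b a)^n`), `Matrix.IsHermitian.pow`, `norm_inner_le_norm`, `EuclideanSpace`; it has
no Hilbert–Schmidt Cauchy–Schwarz for `Matrix.trace` and none of the power inequalities
(`rg "Golden|Thompson|trace_pow.*le"` over Mathlib: nothing relevant).

## Design notes

The sibling file `TraceInequalities.lean` (same namespace) treats i)–iii) over an `RCLike` field
with Mathlib's `Matrix.toMatrixInnerProductSpace`; the names here are kept disjoint from it
(`norm_trace_mul_le_sqrt_mul_sqrt`, `trace_mul_pow_swap`, `trace_conjTranspose_pow_mul_pow_re_le`)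
so that both modules can be imported together (the root `Literature` module imports both).

Everything is over `ℂ` and a `Fintype` index (the generality of the consumers). Traces of the
positive matrices `(X Xᴴ)^p` are handled through their real parts; `trace_pow_mul_conjTranspose_re_nonneg`
records nonnegativity for even exponents, which is all the induction needs.
-/

namespace Literature.MathematicalPhysics.QuantumLattice

open Matrix

variable {n : Type*} [Fintype n] [DecidableEq n]

/-! ### Hilbert–Schmidt norm and Cauchy–Schwarz -/

omit [DecidableEq n] in
/-- `tr (X Xᴴ) = Σᵢⱼ |Xᵢⱼ|²`. Koma–Tasaki, PRL 68 (1992) 3248, inequality i). [folklore] -/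
theorem trace_mul_conjTranspose_self_eq (X : Matrix n n ℂ) :
    (X * Xᴴ).trace = ((∑ i, ∑ j, ‖X i j‖ ^ 2 : ℝ) : ℂ) := by
  simp [Matrix.trace, Matrix.mul_apply, Complex.mul_conj']

omit [DecidableEq n] in
/-- `re tr (X Xᴴ) = Σᵢⱼ |Xᵢⱼ|²`. [folklore] -/
theorem trace_mul_conjTranspose_self_re (X : Matrix n n ℂ) :
    (X * Xᴴ).trace.re = ∑ i, ∑ j, ‖X i j‖ ^ 2 := by
  rw [trace_mul_conjTranspose_self_eq, Complex.ofReal_re]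

omit [DecidableEq n] in
/-- `tr (X Xᴴ)` has vanishing imaginary part. [folklore] -/
theorem trace_mul_conjTranspose_self_im (X : Matrix n n ℂ) : (X * Xᴴ).trace.im = 0 := by
  rw [trace_mul_conjTranspose_self_eq, Complex.ofReal_im]

omit [DecidableEq n] in
/-- `0 ≤ re tr (X Xᴴ)`. [folklore] -/
theorem trace_mul_conjTranspose_self_re_nonneg (X : Matrix n n ℂ) : 0 ≤ (X * Xᴴ).trace.re := by
  rw [trace_mul_conjTranspose_self_re]
  exact Finset.sum_nonneg fun i _ => Finset.sum_nonneg fun j _ => by positivity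

omit [DecidableEq n] in
/-- **Cauchy–Schwarz for the trace** (Hilbert–Schmidt inner product):
`|tr (A B)| ≤ (re tr A Aᴴ)^{1/2} (re tr Bᴴ B)^{1/2}`.
Koma–Tasaki, PRL 68 (1992) 3248, inequality i). [cite: KomaTasakiPRL1992, inequality i)] -/
theorem norm_trace_mul_le_sqrt_mul_sqrt (A B : Matrix n n ℂ) :
    ‖(A * B).trace‖ ≤ √((A * Aᴴ).trace.re) * √((Bᴴ * B).trace.re) := by
  let u : EuclideanSpace ℂ (n × n) := WithLp.toLp 2 (fun p => star (A p.1 p.2))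
  let v : EuclideanSpace ℂ (n × n) := WithLp.toLp 2 (fun p => B p.2 p.1)
  have h1 : inner ℂ u v = (A * B).trace := by
    simp [u, v, EuclideanSpace.inner_eq_star_dotProduct, dotProduct, Matrix.trace, Matrix.mul_apply,
      Fintype.sum_prod_type, mul_comm]
  have h2 : ‖u‖ = √((A * Aᴴ).trace.re) := by
    rw [EuclideanSpace.norm_eq, trace_mul_conjTranspose_self_re]
    congr 1
    simp [u, Fintype.sum_prod_type]
  have h3 : ‖v‖ = √((Bᴴ * B).trace.re) := by
    rw [EuclideanSpace.norm_eq, trace_mul_comm, trace_mul_conjTranspose_self_re]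
    congr 1
    rw [Fintype.sum_prod_type, Finset.sum_comm]
  rw [← h1, ← h2, ← h3]
  exact norm_inner_le_norm u v

omit [DecidableEq n] in
/-- Cauchy–Schwarz for the trace, squared form: `|tr (A B)|² ≤ re tr (A Aᴴ) · re tr (Bᴴ B)`.
Koma–Tasaki, PRL 68 (1992) 3248, inequality i). [cite: KomaTasakiPRL1992, inequality i)] -/
theorem norm_trace_mul_sq_le (A B : Matrix n n ℂ) :
    ‖(A * B).trace‖ ^ 2 ≤ (A * Aᴴ).trace.re * (Bᴴ * B).trace.re := by
  have h := norm_trace_mul_le_sqrt_mul_sqrt A B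
  have ha := trace_mul_conjTranspose_self_re_nonneg A
  have hb : 0 ≤ (Bᴴ * B).trace.re := by
    rw [trace_mul_comm]; exact trace_mul_conjTranspose_self_re_nonneg B
  calc ‖(A * B).trace‖ ^ 2 ≤ (√((A * Aᴴ).trace.re) * √((Bᴴ * B).trace.re)) ^ 2 := by
        gcongr
    _ = (A * Aᴴ).trace.re * (Bᴴ * B).trace.re := by
        rw [mul_pow, Real.sq_sqrt ha, Real.sq_sqrt hb]

/-! ### Traces of powers of `X Xᴴ` -/

/-- `(X Y)^(k+1) = X (Y X)^k Y`. [folklore] -/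
theorem mul_pow_succ_eq (X Y : Matrix n n ℂ) (k : ℕ) :
    (X * Y) ^ (k + 1) = X * (Y * X) ^ k * Y := by
  rw [pow_succ, ← mul_assoc, mul_pow_mul]

/-- `tr (X Y)^k = tr (Y X)^k` (cyclicity of the trace). [folklore] -/
theorem trace_mul_pow_swap (X Y : Matrix n n ℂ) (k : ℕ) :
    ((X * Y) ^ k).trace = ((Y * X) ^ k).trace := by
  cases k with
  | zero => simp
  | succ k => rw [mul_pow_succ_eq, trace_mul_cycle, ← pow_succ']

/-- `tr (X Xᴴ)^k = tr (Xᴴ X)^k`. Koma–Tasaki, PRL 68 (1992) 3248, footnote [14]. [folklore] -/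
theorem trace_pow_mul_conjTranspose_comm (X : Matrix n n ℂ) (k : ℕ) :
    ((X * Xᴴ) ^ k).trace = ((Xᴴ * X) ^ k).trace :=
  trace_mul_pow_swap X Xᴴ k

/-- For a Hermitian matrix `P`, `tr P^{2q} = re tr (P^q (P^q)ᴴ) ≥ 0` is real: the trace of an
even power of a Hermitian matrix is a nonnegative real. [folklore] -/
theorem trace_pow_two_mul_eq_of_isHermitian {P : Matrix n n ℂ} (hP : P.IsHermitian) (q : ℕ) :
    (P ^ (2 * q)).trace = ((P ^ q * (P ^ q)ᴴ).trace.re : ℂ) := by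
  have h : P ^ (2 * q) = P ^ q * (P ^ q)ᴴ := by
    rw [(hP.pow q).eq, ← pow_add, two_mul]
  rw [h]
  exact Complex.ext (by simp) (by rw [Complex.ofReal_im, trace_mul_conjTranspose_self_im])

/-- The trace of an even power of a Hermitian matrix is a nonnegative real number. [folklore] -/
theorem trace_pow_two_mul_re_nonneg_of_isHermitian {P : Matrix n n ℂ} (hP : P.IsHermitian)
    (q : ℕ) : 0 ≤ (P ^ (2 * q)).trace.re := by
  rw [trace_pow_two_mul_eq_of_isHermitian hP q, Complex.ofReal_re]
  exact trace_mul_conjTranspose_self_re_nonneg _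

/-- The norm of the trace of an even power of a Hermitian matrix is its real part. [folklore] -/
theorem norm_trace_pow_two_mul_of_isHermitian {P : Matrix n n ℂ} (hP : P.IsHermitian) (q : ℕ) :
    ‖(P ^ (2 * q)).trace‖ = (P ^ (2 * q)).trace.re := by
  have h0 := trace_pow_two_mul_re_nonneg_of_isHermitian hP q
  rw [trace_pow_two_mul_eq_of_isHermitian hP q, Complex.norm_real, Complex.ofReal_re,
    Real.norm_of_nonneg]
  rwa [trace_pow_two_mul_eq_of_isHermitian hP q, Complex.ofReal_re] at h0

/-- Cauchy–Schwarz for powers of two Hermitian matrices with equal even moments: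
if `tr P^{2q} = tr Q^{2q}` then `|tr (P^q Q^q)| ≤ re tr P^{2q}`. [folklore] -/
theorem norm_trace_pow_mul_pow_le {P Q : Matrix n n ℂ} (hP : P.IsHermitian) (hQ : Q.IsHermitian)
    (q : ℕ) (hPQ : (P ^ (2 * q)).trace = (Q ^ (2 * q)).trace) :
    ‖(P ^ q * Q ^ q).trace‖ ≤ (P ^ (2 * q)).trace.re := by
  have h := norm_trace_mul_le_sqrt_mul_sqrt (P ^ q) (Q ^ q)
  have h1 : (P ^ q * (P ^ q)ᴴ).trace.re = (P ^ (2 * q)).trace.re := by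
    rw [trace_pow_two_mul_eq_of_isHermitian hP q, Complex.ofReal_re]
  have h2 : ((Q ^ q)ᴴ * Q ^ q).trace.re = (P ^ (2 * q)).trace.re := by
    rw [trace_mul_comm, hPQ, trace_pow_two_mul_eq_of_isHermitian hQ q,
      Complex.ofReal_re]
  rw [h1, h2, ← Real.sqrt_mul (trace_pow_two_mul_re_nonneg_of_isHermitian hP q),
    Real.sqrt_mul_self (trace_pow_two_mul_re_nonneg_of_isHermitian hP q)] at h
  exact h

/-! ### The dyadic induction -/

/-- The two statements proved jointly by induction on `j` (`p = 2^j`):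
(a) `|tr X^{2p}| ≤ re tr (X Xᴴ)^p` for every `X`;
(b) `|tr (P Q)^p| ≤ |tr (P^p Q^p)|` for all Hermitian `P, Q`.
Golden, Phys. Rev. 137 (1965) B1127, Lemma; Lieb–Thirring (1976) App. B. [folklore] -/
private theorem dyadic_induction (j : ℕ) :
    (∀ X : Matrix n n ℂ, ‖(X ^ (2 * 2 ^ j)).trace‖ ≤ ((X * Xᴴ) ^ 2 ^ j).trace.re) ∧
    (∀ P Q : Matrix n n ℂ, P.IsHermitian → Q.IsHermitian →
      ‖((P * Q) ^ 2 ^ j).trace‖ ≤ ‖(P ^ 2 ^ j * Q ^ 2 ^ j).trace‖) := by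
  induction j with
  | zero =>
    refine ⟨fun X => ?_, fun P Q _ _ => by simp⟩
    -- `|tr X²| ≤ re tr X Xᴴ` by Cauchy–Schwarz
    have h := norm_trace_mul_le_sqrt_mul_sqrt X X
    rw [trace_mul_comm Xᴴ X, ← Real.sqrt_mul (trace_mul_conjTranspose_self_re_nonneg X),
      Real.sqrt_mul_self (trace_mul_conjTranspose_self_re_nonneg X)] at h
    simpa [pow_two] using h
  | succ j ih =>
    obtain ⟨iha, ihb⟩ := ih
    -- abbreviate `p = 2^j`, so `2^(j+1) = 2p`
    have hp : (2 : ℕ) ^ (j + 1) = 2 * 2 ^ j := by rw [pow_succ, mul_comm]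
    -- (b) at level `j+1` from (a) and (b) at level `j`
    have hb : ∀ P Q : Matrix n n ℂ, P.IsHermitian → Q.IsHermitian →
        ‖((P * Q) ^ 2 ^ (j + 1)).trace‖ ≤ ‖(P ^ 2 ^ (j + 1) * Q ^ 2 ^ (j + 1)).trace‖ := by
      intro P Q hP hQ
      -- `|tr (PQ)^{2p}| ≤ re tr ((PQ)(PQ)ᴴ)^p = re tr (P Q Q P)^p = re tr (P² Q²)^p`
      have h1 := iha (P * Q)
      have h2 : ((P * Q * (P * Q)ᴴ) ^ 2 ^ j).trace = ((P ^ 2 * Q ^ 2) ^ 2 ^ j).trace := by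
        rw [conjTranspose_mul, hP.eq, hQ.eq, ← mul_assoc, trace_mul_pow_swap (P * Q * Q) P, pow_two,
          pow_two]
        simp only [mul_assoc]
      have h3 := ihb (P ^ 2) (Q ^ 2) (hP.pow 2) (hQ.pow 2)
      rw [hp]
      calc ‖((P * Q) ^ (2 * 2 ^ j)).trace‖ ≤ ((P * Q * (P * Q)ᴴ) ^ 2 ^ j).trace.re := h1
        _ = ((P ^ 2 * Q ^ 2) ^ 2 ^ j).trace.re := congrArg Complex.re h2
        _ ≤ ‖((P ^ 2 * Q ^ 2) ^ 2 ^ j).trace‖ := Complex.re_le_norm _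
        _ ≤ ‖((P ^ 2) ^ 2 ^ j * (Q ^ 2) ^ 2 ^ j).trace‖ := h3
        _ = ‖(P ^ (2 * 2 ^ j) * Q ^ (2 * 2 ^ j)).trace‖ := by rw [← pow_mul, ← pow_mul]
    refine ⟨fun X => ?_, hb⟩
    -- (a) at level `j+1`: `|tr X^{4p}| = |tr (X²)^{2p}| ≤ re tr (X² X²ᴴ)^p = re tr (XXᴴ · XᴴX)^p`
    have h1 := iha (X ^ 2)
    have hcyc : ((X ^ 2 * (X ^ 2)ᴴ) ^ 2 ^ j).trace = ((X * Xᴴ * (Xᴴ * X)) ^ 2 ^ j).trace := by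
      rw [conjTranspose_pow, pow_two, pow_two, show X * X * (Xᴴ * Xᴴ) = X * (X * Xᴴ * Xᴴ) by
        simp only [mul_assoc], trace_mul_pow_swap, show X * Xᴴ * Xᴴ * X = X * Xᴴ * (Xᴴ * X) by
        simp only [mul_assoc]]
    -- then (b) at level `j` for the Hermitian pair `X Xᴴ`, `Xᴴ X`, and Cauchy–Schwarz
    have hH1 : (X * Xᴴ).IsHermitian := isHermitian_mul_conjTranspose_self X
    have hH2 : (Xᴴ * X).IsHermitian := isHermitian_conjTranspose_mul_self X
    have h2 := ihb (X * Xᴴ) (Xᴴ * X) hH1 hH2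
    have hmom : ((X * Xᴴ) ^ (2 * 2 ^ j)).trace = ((Xᴴ * X) ^ (2 * 2 ^ j)).trace :=
      trace_pow_mul_conjTranspose_comm X _
    have h3 := norm_trace_pow_mul_pow_le hH1 hH2 (2 ^ j) hmom
    rw [hp, pow_mul X 2 (2 * 2 ^ j)]
    calc ‖((X ^ 2) ^ (2 * 2 ^ j)).trace‖ ≤ ((X ^ 2 * (X ^ 2)ᴴ) ^ 2 ^ j).trace.re := h1
      _ = ((X * Xᴴ * (Xᴴ * X)) ^ 2 ^ j).trace.re := congrArg Complex.re hcyc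
      _ ≤ ‖((X * Xᴴ * (Xᴴ * X)) ^ 2 ^ j).trace‖ := Complex.re_le_norm _
      _ ≤ ‖((X * Xᴴ) ^ 2 ^ j * (Xᴴ * X) ^ 2 ^ j).trace‖ := h2
      _ ≤ ((X * Xᴴ) ^ (2 * 2 ^ j)).trace.re := h3

/-- **Golden's lemma** (dyadic form). For every square complex matrix `X` and `p = 2^j`,
`|tr X^{2p}| ≤ tr (X Xᴴ)^p` (the right-hand side is a nonnegative real,
`trace_pow_two_mul_re_nonneg_of_isHermitian`). Golden, Phys. Rev. 137 (1965) B1127, Lemma;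
Lieb–Thirring (1976), App. B. [cite: KomaTasakiPRL1992, footnote 14] -/
theorem norm_trace_pow_two_mul_le (X : Matrix n n ℂ) (j : ℕ) :
    ‖(X ^ (2 * 2 ^ j)).trace‖ ≤ ((X * Xᴴ) ^ 2 ^ j).trace.re :=
  (dyadic_induction j).1 X

/-- **Golden's lemma** for two Hermitian matrices: `|tr (P Q)^N| ≤ |tr (P^N Q^N)|` for
`N = 2^j`. With `P = e^{A/N}`, `Q = e^{B/N}` and the Lie product formula this is the
Golden–Thompson inequality. Golden, Phys. Rev. 137 (1965) B1127, Lemma; Koma–Tasaki, PRL 68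
(1992) 3248, footnote [14] ("`Tr[(AB)^{2^k}] ≤ Tr[A^{2^k} B^{2^k}]`").
[cite: KomaTasakiPRL1992, footnote 14] -/
theorem norm_trace_mul_pow_le {P Q : Matrix n n ℂ} (hP : P.IsHermitian) (hQ : Q.IsHermitian)
    (j : ℕ) : ‖((P * Q) ^ 2 ^ j).trace‖ ≤ ‖(P ^ 2 ^ j * Q ^ 2 ^ j).trace‖ :=
  (dyadic_induction j).2 P Q hP hQ

/-- **Koma–Tasaki's inequality iii)**: `tr ((Xᴴ)^N X^N) ≤ tr (Xᴴ X)^N` for `N = 2^m` and an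
arbitrary square complex matrix `X` (both sides are nonnegative reals; stated for the real parts,
with `trace_conjTranspose_pow_mul_pow_eq` identifying the left side as `Σ |(X^N)ᵢⱼ|²`).
Proof (footnote [14] of the source): with `αₖ = X^{2^{m-k}} (Xᴴ)^{2^{m-k}}`,
`βₖ = (Xᴴ)^{2^{m-k}} X^{2^{m-k}}`, one has `tr αₖ^{2^k} = tr (αₖ₊₁ βₖ₊₁)^{2^k} ≤
|tr αₖ₊₁^{2^k} βₖ₊₁^{2^k}| ≤ tr αₖ₊₁^{2^{k+1}}` by Golden's lemma and Cauchy–Schwarz.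
Koma–Tasaki, PRL 68 (1992) 3248, inequality iii) and footnote [14].
[cite: KomaTasakiPRL1992, inequality iii) and footnote 14] -/
theorem trace_conjTranspose_pow_mul_pow_re_le (X : Matrix n n ℂ) (m : ℕ) :
    ((Xᴴ ^ 2 ^ m * X ^ 2 ^ m).trace).re ≤ (((Xᴴ * X) ^ 2 ^ m).trace).re := by
  -- we prove `re tr (X^{2^i} (Xᴴ)^{2^i})^{2^k} ≤ re tr (X Xᴴ)^{2^(i+k)}` by induction on `i`
  suffices h : ∀ i k : ℕ, (((X ^ 2 ^ i * Xᴴ ^ 2 ^ i) ^ 2 ^ k).trace).re ≤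
      (((X * Xᴴ) ^ 2 ^ (i + k)).trace).re by
    have := h m 0
    rw [pow_zero, pow_one, add_zero, trace_pow_mul_conjTranspose_comm, trace_mul_comm] at this
    exact this
  intro i
  induction i with
  | zero => intro k; simp
  | succ i ih =>
    intro k
    -- `α_i₊₁ = X^{2p} (Xᴴ)^{2p} = X^p α' (Xᴴ)^p` with `α' = X^p (Xᴴ)^p`, `β' = (Xᴴ)^p X^p`, `p = 2^i`
    set p : ℕ := 2 ^ i with hp_def
    have hp2 : (2 : ℕ) ^ (i + 1) = p + p := by rw [pow_succ, hp_def]; ring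
    set α' : Matrix n n ℂ := X ^ p * Xᴴ ^ p
    set β' : Matrix n n ℂ := Xᴴ ^ p * X ^ p
    have hα' : α'.IsHermitian := by
      simpa [α', conjTranspose_pow] using isHermitian_mul_conjTranspose_self (X ^ p)
    have hβ' : β'.IsHermitian := by
      simpa [β', conjTranspose_pow] using isHermitian_conjTranspose_mul_self (X ^ p)
    -- cyclicity: `tr (X^{2p} (Xᴴ)^{2p})^{2^k} = tr (α' β')^{2^k}`
    have hcyc : ((X ^ 2 ^ (i + 1) * Xᴴ ^ 2 ^ (i + 1)) ^ 2 ^ k).trace =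
        ((α' * β') ^ 2 ^ k).trace := by
      rw [hp2, pow_add, pow_add, show X ^ p * X ^ p * (Xᴴ ^ p * Xᴴ ^ p) =
        X ^ p * (X ^ p * Xᴴ ^ p * Xᴴ ^ p) by simp only [mul_assoc], trace_mul_pow_swap]
      simp only [α', β', mul_assoc]
    -- equal even moments of `α'` and `β'`
    have hmom : (α' ^ (2 * 2 ^ k)).trace = (β' ^ (2 * 2 ^ k)).trace := by
      simp only [α', β']
      rw [show Xᴴ ^ p = (X ^ p)ᴴ by rw [conjTranspose_pow]]
      exact trace_pow_mul_conjTranspose_comm (X ^ p) _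
    have h1 := norm_trace_mul_pow_le hα' hβ' k
    have h2 := norm_trace_pow_mul_pow_le hα' hβ' (2 ^ k) hmom
    have h3 := ih (k + 1)
    rw [show i + (k + 1) = i + 1 + k by ring] at h3
    calc (((X ^ 2 ^ (i + 1) * Xᴴ ^ 2 ^ (i + 1)) ^ 2 ^ k).trace).re
        = (((α' * β') ^ 2 ^ k).trace).re := congrArg Complex.re hcyc
      _ ≤ ‖((α' * β') ^ 2 ^ k).trace‖ := Complex.re_le_norm _
      _ ≤ ‖(α' ^ 2 ^ k * β' ^ 2 ^ k).trace‖ := h1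
      _ ≤ (α' ^ (2 * 2 ^ k)).trace.re := h2
      _ = ((α' ^ 2 ^ (k + 1)).trace).re := by rw [pow_succ, mul_comm]
      _ ≤ (((X * Xᴴ) ^ 2 ^ (i + 1 + k)).trace).re := h3

omit [DecidableEq n] in
/-- The left side of Koma–Tasaki iii) is the Hilbert–Schmidt norm `Σ |(X^N)ᵢⱼ|² ≥ 0` (here for
`DecidableEq`-free general products: `re tr (Yᴴ Y) = Σ |Yᵢⱼ|²`). [folklore] -/
theorem trace_conjTranspose_mul_self_re (Y : Matrix n n ℂ) :
    (Yᴴ * Y).trace.re = ∑ i, ∑ j, ‖Y i j‖ ^ 2 := by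
  rw [trace_mul_comm, trace_mul_conjTranspose_self_re]

end Literature.MathematicalPhysics.QuantumLattice
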